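import Summits.QuantumFields.BalabanUV.T4Continuum.Support.NE3LinearNormalPartPreSizes
import HarnessLib

/-!
# T⁴ programme, node NE3 — route Π, item 3d «(Π-REG)-NV»: THE SQUARE-SUMMABLE LOCAL SUP MAJORANT IS INHABITED — explicit
# fields with displayed O(1) constants (`C = 1` for unimodular fields, `C = √d` for one polarisation), the degenerate inhabitant,
# and WHAT THE SHAPE FORBIDS: a field concentrated on ONE bond needs `C ≥ (L^k)^{d∕2}`

NE3 formalisation swarm `b2b-balaban-t4-ne3-formalise-*`, LEAF PROVER 03 (gen 11); the row NE3 OWNER's OFFER ρ-g25-2 (5)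
(HOME/CLAIMS.log l.22968: «kernel item 3d (Π-REG)-NV: a non-vacuity witness of `LocalSupMajorant` at W = 1 for an explicit smooth field …
C = O(1) displayed — the K6c-2-NV of route Π»); INTENT l.23524.  The SHAPES are the owner's `NE3LinearNormalPartPreSizes.LocalSupMajorant`
(file 3a of D-ne3p1-g25-1 §4, p240565; box form) and `NE3DecomposedRepOfShapes.LocalSupMajorantBall` (file 4 = the junction, p242094; ball form),
consumed BY NAME — fields `nonneg` ∕ `dom` ∕ `hC` ∕ `sq`; it does not mention the background, so
«at W = 1» is automatic: the witnesses are bond fields `X₀` with a majorant `m` and a constant `C`, at every `L, N, k`, every `d` and `n`.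

CONTENT (all [folklore]; 0 sorry; 0 def — the fields are written as lambdas):
§1 THE PRINCIPLE `localSupMajorant_of_sup_of_mass`: a global sup bound `‖X₀‖ ≤ r` is a majorant on every block union, and `sq` reduces by
   `card_periodBox` to ONE «mass» inequality `(L^k)^d·N^d·d·r² ≤ C²·dirSq X₀ (periodBox (N·L^k))`;
§2 UNIMODULAR FIELDS (`‖X₀ x μ‖ = r` everywhere) satisfy it with **`C = 1`** EXACTLY (`dirSq = (N·L^k)^d·d·r²`): the constant field
   `fun _ _ => A` (`localSupMajorant_const`) and every SIGN WAVE `fun x μ => (s x μ : ℂ) • A`, `|s| = 1` (`localSupMajorant_signWave`) — e.g. the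
   blockwise sign wave `s x μ = (−1)^{⌊x_{i₀}∕L^k⌋}` along an axis, blockwise constant and not constant;
§3 ONE POLARISATION `fun x μ => if μ = μ₀ then A else 0`: majorant `‖A‖`, **`C = √d`** (`dirSq = (N·L^k)^d·‖A‖²`), and the identity
   `(L^k)^d·Σ m² = d·dirSq` showing that no smaller constant serves THIS majorant;
§4 the degenerate inhabitant `X₀ = 0`, `m = 0`, `C = 0`;
§5 WHAT THE SHAPE FORBIDS: for the ONE-BOND field `fun x μ => if x = x₀ ∧ μ = μ₀ then A else 0` (`x₀` in the period box, `A ≠ 0`) EVERY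
   admissible pair `(m, C)` has `(L^k)^d ≤ C²` — the `dom` clause at the coarse bond `(⌊x₀∕L^k⌋, μ₀)` forces `m ≥ ‖A‖` there while `dirSq X₀ = ‖A‖²`;
   so a k-FREE constant is exactly the exclusion of fields concentrated below the block scale (NE3-R2's «scale M vs scale L» question, in kernel form);
§6 `example`s at d = 4, L = 2;
(the same witnesses for the BALL form `NE3DecomposedRepOfShapes.LocalSupMajorantBall` — the shape the junction `decomposedRep_of_shapes`
   p242094 actually consumes — are the sibling file `Support/NE3LocalSupMajorantBallWitness.lean`, which imports this one).

HONEST FRAMING.  A NON-VACUITY witness (and one necessity line) for OUR hypothesis shape (Π-REG); it says NOTHING about the relative field of a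
minimiser pair — that the pair field admits such a majorant with k-free `C` is [Balaban1985Variational] Thm 1 ∕ Prop 2 regularity TYPE, a typed
leaf, asserted for nothing; `DecomposedRep`'s three sizes, (P♮)_W's class budget, T-E_w♯ and NE3 are NOT proved; spine PROVED 0∕9; finite T⁴ rung
(B)+1 — NOT infinite volume, NOT mass gap, NOT BetaPertH, NOT Clay.  ABSOLUTE RULE kept (no printed sentence is a hypothesis; context only:
[Balaban1985Averaging] p. 24 (the block union `B^k(c₋) ∪ B^k(c₊)`), [Balaban1985Variational] Prop. 2 p. 281).  PLACEMENT:
`Summits/QuantumFields/BalabanUV/`.  HONEST DEPENDENCY: continuum YM on T⁴ ⇐ BetaPertH ∧ nine spine estimates (0/9 proved); BetaPertH ⇐ (D1) ∧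
(D4) ∧ CAP+tail; G-an2-4 gates asym, D1 and NE2/3/4.
-/

set_option autoImplicit false

open scoped BigOperators Matrix.Norms.L2Operator
open Finset

namespace Summit.QuantumFields.BalabanUV.T4Continuum.NE3LocalSupMajorantWitness

open Literature.MathematicalPhysics.QuantumFieldTheory.Balaban1983to89
open B7Prop1Explicit B7Prop1Local
open T4AveragingDeficitWall (dirSq)
open T4AveragingDeficitWallBoundary (periodBox card_periodBox mem_periodBox)
open NE3LinearNormalPartPreSizes (LocalSupMajorant)

noncomputable section

variable {d : ℕ} {n : Type*} [Fintype n] [DecidableEq n]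

/-! ## §1 The principle: a global sup and one mass inequality -/

omit [DecidableEq n] in
/-- The coarse sum of a constant majorant: `Σ_{z ∈ periodBox N} Σ_κ r² = N^d·(d·r²)`. [folklore] -/
theorem sum_periodBox_const (N : ℕ) (r : ℝ) :
    ∑ _z ∈ periodBox (d := d) N, ∑ _κ : Fin d, r ^ 2 = (N : ℝ) ^ d * ((d : ℝ) * r ^ 2) := by
  simp only [Finset.sum_const, Finset.card_univ, Fintype.card_fin, nsmul_eq_mul, card_periodBox]
  push_cast
  ring

/-- **THE PRINCIPLE.**  A field with a GLOBAL sup bound `‖X₀ x μ‖ ≤ r` (`r ≥ 0`) carries the constant majorant `m ≡ r` on every block union,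
and the square-summability clause of (Π-REG) reduces to ONE mass inequality
`(L^k)^d·N^d·d·r² ≤ C²·dirSq X₀ (periodBox (N·L^k))`. [folklore] -/
theorem localSupMajorant_of_sup_of_mass {L N k : ℕ} {X₀ : Site d → Fin d → Matrix n n ℂ} {r C : ℝ} (hr : 0 ≤ r)
    (hX : ∀ (x : Site d) (μ : Fin d), ‖X₀ x μ‖ ≤ r) (hC : 0 ≤ C)
    (hmass : ((L : ℝ) ^ k) ^ d * ((N : ℝ) ^ d * ((d : ℝ) * r ^ 2)) ≤ C ^ 2 * dirSq X₀ (periodBox (d := d) (N * L ^ k))) :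
    LocalSupMajorant L N k X₀ (fun _ _ => r) C where
  nonneg := fun _ _ => hr
  dom := fun _ _ x μ _ _ => hX x μ
  hC := hC
  sq := by rw [sum_periodBox_const]; exact hmass

/-! ## §2 Unimodular fields: `C = 1` exactly -/

/-- The quadratic mass of a unimodular field: `‖X₀ x μ‖ = r` everywhere ⇒ `dirSq X₀ F = |F|·(d·r²)`. [folklore] -/
theorem dirSq_of_norm_eq {X₀ : Site d → Fin d → Matrix n n ℂ} {r : ℝ} (hX : ∀ (x : Site d) (μ : Fin d), ‖X₀ x μ‖ = r)
    (F : Finset (Site d)) : dirSq X₀ F = (F.card : ℝ) * ((d : ℝ) * r ^ 2) := by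
  unfold dirSq
  simp only [hX, Finset.sum_const, Finset.card_univ, Fintype.card_fin, nsmul_eq_mul]

/-- **UNIMODULAR FIELDS ARE (Π-REG) WITH `C = 1`**: if `‖X₀ x μ‖ = r` for every bond then `LocalSupMajorant L N k X₀ (fun _ _ => r) 1`
(the mass inequality is the identity `(L^k)^d·N^d·d·r² = (N·L^k)^d·d·r²`). [folklore] -/
theorem localSupMajorant_of_norm_eq {L N k : ℕ} {X₀ : Site d → Fin d → Matrix n n ℂ} {r : ℝ} (hr : 0 ≤ r)
    (hX : ∀ (x : Site d) (μ : Fin d), ‖X₀ x μ‖ = r) : LocalSupMajorant L N k X₀ (fun _ _ => r) 1 := by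
  refine localSupMajorant_of_sup_of_mass hr (fun x μ => (hX x μ).le) zero_le_one (le_of_eq ?_)
  have e1 : dirSq X₀ (periodBox (d := d) (N * L ^ k)) = (((N * L ^ k) ^ d : ℕ) : ℝ) * ((d : ℝ) * r ^ 2) := by
    rw [dirSq_of_norm_eq hX, card_periodBox]
  rw [e1]
  push_cast
  ring

/-- **THE CONSTANT FIELD** `X₀ ≡ A` (the plane wave of wave number zero): majorant `‖A‖`, `C = 1`, at every `L, N, k`. [folklore] -/
theorem localSupMajorant_const (L N k : ℕ) (A : Matrix n n ℂ) :
    LocalSupMajorant L N k (fun (_ : Site d) (_ : Fin d) => A) (fun _ _ => ‖A‖) 1 :=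
  localSupMajorant_of_norm_eq (norm_nonneg A) fun _ _ => rfl

omit [Fintype n] [DecidableEq n] in
/-- A unit real factor does not change the norm: `|s| = 1 ⇒ ‖(s : ℂ) • A‖ = ‖A‖`. [folklore] -/
theorem norm_real_smul_of_abs_eq_one [Fintype n] [DecidableEq n] {s : ℝ} (hs : |s| = 1) (A : Matrix n n ℂ) :
    ‖((s : ℝ) : ℂ) • A‖ = ‖A‖ := by
  rw [norm_smul, Complex.norm_real, Real.norm_eq_abs, hs, one_mul]

/-- **SIGN WAVES** `X₀ x μ := (s x μ : ℂ) • A` with `|s x μ| = 1` (blockwise sign patterns, site-wise alternating signs, …): majorant `‖A‖`,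
`C = 1`. [folklore] -/
theorem localSupMajorant_signWave (L N k : ℕ) (s : Site d → Fin d → ℝ) (hs : ∀ (x : Site d) (μ : Fin d), |s x μ| = 1)
    (A : Matrix n n ℂ) :
    LocalSupMajorant L N k (fun (x : Site d) (μ : Fin d) => ((s x μ : ℝ) : ℂ) • A) (fun _ _ => ‖A‖) 1 :=
  localSupMajorant_of_norm_eq (norm_nonneg A) fun x μ => norm_real_smul_of_abs_eq_one (hs x μ) A

/-- **THE BLOCKWISE SIGN WAVE ALONG AN AXIS** `X₀ x μ := (−1)^{⌊x_{i₀} ∕ L^k⌋} • A` (integer division; constant on every block of side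
`L^k`, alternating from block to block along `e_{i₀}` on the non-negative half-lattice): majorant `‖A‖`, `C = 1`, at every `L, N, k`. [folklore] -/
theorem localSupMajorant_blockSignWave (L N k : ℕ) (i₀ : Fin d) (A : Matrix n n ℂ) :
    LocalSupMajorant L N k
      (fun (x : Site d) (_ : Fin d) => ((((-1 : ℝ) ^ (x i₀ / ((L : ℤ) ^ k)).natAbs : ℝ)) : ℂ) • A) (fun _ _ => ‖A‖) 1 :=
  localSupMajorant_signWave L N k (fun x _ => (-1 : ℝ) ^ (x i₀ / ((L : ℤ) ^ k)).natAbs) (fun _ _ => abs_neg_one_pow _) A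

/-! ## §3 One polarisation: `C = √d` -/

/-- The norm of the one-polarisation field: `‖A‖` on `μ₀`-bonds, `0` elsewhere. [folklore] -/
theorem norm_onePol (μ₀ : Fin d) (A : Matrix n n ℂ) (μ : Fin d) :
    ‖(if μ = μ₀ then A else (0 : Matrix n n ℂ))‖ = if μ = μ₀ then ‖A‖ else 0 := by
  split_ifs <;> simp

/-- Its quadratic mass: `dirSq = |F|·‖A‖²`. [folklore] -/
theorem dirSq_onePol (μ₀ : Fin d) (A : Matrix n n ℂ) (F : Finset (Site d)) :
    dirSq (fun (_ : Site d) (μ : Fin d) => if μ = μ₀ then A else (0 : Matrix n n ℂ)) F = (F.card : ℝ) * ‖A‖ ^ 2 := by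
  unfold dirSq
  have h1 : ∀ _x ∈ F, ∑ μ : Fin d, ‖(if μ = μ₀ then A else (0 : Matrix n n ℂ))‖ ^ 2 = ‖A‖ ^ 2 := by
    intro _ _
    rw [Finset.sum_eq_single μ₀]
    · simp
    · intro μ _ hne; simp [hne]
    · intro h; exact absurd (Finset.mem_univ μ₀) h
  rw [Finset.sum_congr rfl h1, Finset.sum_const, nsmul_eq_mul]

/-- **ONE POLARISATION IS (Π-REG) WITH `C = √d`**: `X₀ x μ := A` on `μ₀`-bonds and `0` elsewhere, majorant `‖A‖` on EVERY coarse bond (the block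
union feeding `(z,κ)` contains `μ₀`-bonds for every `κ`), constant `√d` — the mass inequality is the identity `(L^k)^d·N^d·d·‖A‖² = d·(N·L^k)^d·‖A‖²`.
[folklore] -/
theorem localSupMajorant_onePol (L N k : ℕ) (μ₀ : Fin d) (A : Matrix n n ℂ) :
    LocalSupMajorant L N k (fun (_ : Site d) (μ : Fin d) => if μ = μ₀ then A else (0 : Matrix n n ℂ)) (fun _ _ => ‖A‖)
      (Real.sqrt d) := by
  refine localSupMajorant_of_sup_of_mass (norm_nonneg A) (fun _ μ => ?_) (Real.sqrt_nonneg _) (le_of_eq ?_)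
  · rw [norm_onePol μ₀ A μ]; split_ifs
    · exact le_rfl
    · exact norm_nonneg A
  · have e1 : dirSq (fun (_ : Site d) (μ : Fin d) => if μ = μ₀ then A else (0 : Matrix n n ℂ)) (periodBox (d := d) (N * L ^ k))
        = (((N * L ^ k) ^ d : ℕ) : ℝ) * ‖A‖ ^ 2 := by rw [dirSq_onePol, card_periodBox]
    rw [e1, Real.sq_sqrt (Nat.cast_nonneg d)]
    push_cast
    ring

/-- … and no smaller constant serves THIS majorant: `(L^k)^d·Σ_{z,κ}‖A‖² = d·dirSq X₀ (periodBox (N·L^k))` exactly. [folklore] -/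
theorem onePol_mass_identity (L N k : ℕ) (μ₀ : Fin d) (A : Matrix n n ℂ) :
    ((L : ℝ) ^ k) ^ d * ∑ _z ∈ periodBox (d := d) N, ∑ _κ : Fin d, ‖A‖ ^ 2
      = (d : ℝ) * dirSq (fun (_ : Site d) (μ : Fin d) => if μ = μ₀ then A else (0 : Matrix n n ℂ)) (periodBox (d := d) (N * L ^ k)) := by
  have e1 : dirSq (fun (_ : Site d) (μ : Fin d) => if μ = μ₀ then A else (0 : Matrix n n ℂ)) (periodBox (d := d) (N * L ^ k))
      = (((N * L ^ k) ^ d : ℕ) : ℝ) * ‖A‖ ^ 2 := by rw [dirSq_onePol, card_periodBox]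
  rw [sum_periodBox_const, e1]
  push_cast
  ring

/-! ## §4 The degenerate inhabitant -/

/-- The zero field with the zero majorant and `C = 0`. [folklore] -/
theorem localSupMajorant_zero (L N k : ℕ) :
    LocalSupMajorant L N k (fun (_ : Site d) (_ : Fin d) => (0 : Matrix n n ℂ)) (fun _ _ => 0) 0 :=
  localSupMajorant_of_sup_of_mass le_rfl (fun _ _ => by simp) le_rfl (by
    have e1 : ((L : ℝ) ^ k) ^ d * ((N : ℝ) ^ d * ((d : ℝ) * (0 : ℝ) ^ 2)) = 0 := by ring
    rw [e1]
    exact mul_nonneg (sq_nonneg _) (by unfold dirSq; positivity))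

/-! ## §5 What the shape forbids: concentration below the block scale -/

/-- The quadratic mass of the ONE-BOND field is `‖A‖²` on any box containing `x₀`. [folklore] -/
theorem dirSq_oneBond {x₀ : Site d} {μ₀ : Fin d} (A : Matrix n n ℂ) {F : Finset (Site d)} (hx₀ : x₀ ∈ F) :
    dirSq (fun (x : Site d) (μ : Fin d) => if x = x₀ ∧ μ = μ₀ then A else (0 : Matrix n n ℂ)) F = ‖A‖ ^ 2 := by
  classical
  unfold dirSq
  rw [Finset.sum_eq_single x₀]
  · rw [Finset.sum_eq_single μ₀]
    · simp
    · intro μ _ hne; simp [hne]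
    · intro h; exact absurd (Finset.mem_univ μ₀) h
  · intro x _ hne
    refine Finset.sum_eq_zero fun μ _ => ?_
    simp [hne]
  · intro h; exact absurd hx₀ h

/-- The coarse block of a fine site of the period box: `q i := x₀ i ∕ L^k` lies in `periodBox N`, and both `x₀` and `x₀ + e_{μ₀}` lie in the
block union `[L^k q, L^k q + (L^k − 1)𝟙 + L^k e_{μ₀}]` of the coarse bond `(q, μ₀)`. [folklore] -/
theorem block_of_site {L N k : ℕ} (hL : 1 ≤ L) {x₀ : Site d} (hx₀ : x₀ ∈ periodBox (d := d) (N * L ^ k)) (μ₀ : Fin d) :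
    (fun i => x₀ i / ((L : ℤ) ^ k)) ∈ periodBox (d := d) N
      ∧ InBox (loK L k (fun i => x₀ i / ((L : ℤ) ^ k))) (bondHiK L k (fun i => x₀ i / ((L : ℤ) ^ k)) μ₀) x₀
      ∧ InBox (loK L k (fun i => x₀ i / ((L : ℤ) ^ k))) (bondHiK L k (fun i => x₀ i / ((L : ℤ) ^ k)) μ₀) (x₀ + e μ₀) := by
  have hM : (0 : ℤ) < (L : ℤ) ^ k := by positivity
  have hx := mem_periodBox.mp hx₀
  -- Euclidean division, coordinatewise
  have hdiv : ∀ i, ((L : ℤ) ^ k) * (x₀ i / ((L : ℤ) ^ k)) ≤ x₀ i ∧ x₀ i ≤ ((L : ℤ) ^ k) * (x₀ i / ((L : ℤ) ^ k)) + (((L : ℤ) ^ k) - 1) := by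
    intro i
    have h1 := Int.mul_ediv_add_emod (x₀ i) ((L : ℤ) ^ k)
    have h2 := Int.emod_nonneg (x₀ i) hM.ne'
    have h3 := Int.emod_lt_of_pos (x₀ i) hM
    constructor <;> linarith
  refine ⟨mem_periodBox.mpr fun i => ⟨Int.ediv_nonneg (hx i).1 hM.le, ?_⟩, fun i => ?_, fun i => ?_⟩
  · have h := (hx i).2
    rw [Int.ediv_lt_iff_lt_mul hM]
    push_cast at h ⊢
    linarith
  · have h1 := (hdiv i).1
    have h2 := (hdiv i).2
    by_cases hi : i = μ₀
    · subst hi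
      simp only [loK, bondHiK, if_true]
      constructor <;> linarith
    · simp only [loK, bondHiK, hi, if_false]
      constructor <;> linarith
  · have h1 := (hdiv i).1
    have h2 := (hdiv i).2
    by_cases hi : i = μ₀
    · subst hi
      have he : (x₀ + e i) i = x₀ i + 1 := by simp [e]
      simp only [loK, bondHiK, he, if_true]
      constructor <;> linarith
    · have he : (x₀ + e μ₀) i = x₀ i := by simp [e, hi]
      simp only [loK, bondHiK, he, hi, if_false]
      constructor <;> linarith

/-- **WHAT (Π-REG) FORBIDS: A FIELD CONCENTRATED ON ONE BOND NEEDS `C ≥ (L^k)^{d∕2}`.**  For `X₀ := A·1_{(x₀, μ₀)}` with `x₀` in the period box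
and `A ≠ 0`, EVERY admissible `(m, C)` has `(L^k)^d ≤ C²`: the `dom` clause at the coarse bond `(⌊x₀∕L^k⌋, μ₀)` gives `‖A‖ ≤ m` there, so
`(L^k)^d·‖A‖² ≤ (L^k)^d·Σ m² ≤ C²·dirSq X₀ = C²·‖A‖²`.  A k-free constant is exactly the exclusion of concentration below the block scale. [folklore] -/
theorem sq_le_of_oneBond {L N k : ℕ} (hL : 1 ≤ L) {x₀ : Site d} (hx₀ : x₀ ∈ periodBox (d := d) (N * L ^ k)) (μ₀ : Fin d)
    {A : Matrix n n ℂ} (hA : A ≠ 0) {m : Site d → Fin d → ℝ} {C : ℝ}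
    (h : LocalSupMajorant L N k (fun (x : Site d) (μ : Fin d) => if x = x₀ ∧ μ = μ₀ then A else (0 : Matrix n n ℂ)) m C) :
    ((L : ℝ) ^ k) ^ d ≤ C ^ 2 := by
  classical
  obtain ⟨hq, hin, hin'⟩ := block_of_site hL hx₀ μ₀
  set q : Site d := fun i => x₀ i / ((L : ℤ) ^ k) with hqdef
  -- `‖A‖ ≤ m q μ₀`
  have hdom := h.dom q μ₀ x₀ μ₀ hin hin'
  simp only [and_self, ↓reduceIte] at hdom
  -- `m q μ₀ ^ 2 ≤ Σ m²`
  have hterm : m q μ₀ ^ 2 ≤ ∑ z ∈ periodBox (d := d) N, ∑ κ : Fin d, m z κ ^ 2 := by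
    have h1 : m q μ₀ ^ 2 ≤ ∑ κ : Fin d, m q κ ^ 2 :=
      Finset.single_le_sum (f := fun κ => m q κ ^ 2) (fun κ _ => sq_nonneg _) (Finset.mem_univ μ₀)
    exact h1.trans (Finset.single_le_sum (f := fun z => ∑ κ : Fin d, m z κ ^ 2)
      (fun z _ => Finset.sum_nonneg fun κ _ => sq_nonneg _) hq)
  have hsq := h.sq
  rw [dirSq_oneBond A hx₀] at hsq
  have hA0 : 0 < ‖A‖ := norm_pos_iff.mpr hA
  have hA2 : 0 < ‖A‖ ^ 2 := by positivity
  have hMd : 0 ≤ ((L : ℝ) ^ k) ^ d := by positivity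
  have hm2 : ‖A‖ ^ 2 ≤ m q μ₀ ^ 2 := pow_le_pow_left₀ (norm_nonneg _) hdom 2
  have hchain : ((L : ℝ) ^ k) ^ d * ‖A‖ ^ 2 ≤ C ^ 2 * ‖A‖ ^ 2 :=
    calc ((L : ℝ) ^ k) ^ d * ‖A‖ ^ 2 ≤ ((L : ℝ) ^ k) ^ d * ∑ z ∈ periodBox (d := d) N, ∑ κ : Fin d, m z κ ^ 2 :=
          mul_le_mul_of_nonneg_left (hm2.trans hterm) hMd
      _ ≤ C ^ 2 * ‖A‖ ^ 2 := hsq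
  nlinarith [hchain, hA2]

/-! ## §6 Examples at d = 4, L = 2 -/

/-- At d = 4, L = 2, N = 1, k = 1 and `n = Fin 2`: the constant field carries (Π-REG) with `C = 1` … -/
example (A : Matrix (Fin 2) (Fin 2) ℂ) :
    LocalSupMajorant (d := 4) 2 1 1 (fun (_ : Site 4) (_ : Fin 4) => A) (fun _ _ => ‖A‖) 1 :=
  localSupMajorant_const 2 1 1 A

/-- … one polarisation with `C = √4 = 2` … -/
example (A : Matrix (Fin 2) (Fin 2) ℂ) :
    LocalSupMajorant (d := 4) 2 1 1 (fun (_ : Site 4) (μ : Fin 4) => if μ = 0 then A else (0 : Matrix (Fin 2) (Fin 2) ℂ))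
      (fun _ _ => ‖A‖) 2 := by
  have h := localSupMajorant_onePol (d := 4) 2 1 1 (0 : Fin 4) A
  have e : Real.sqrt ((4 : ℕ) : ℝ) = 2 := by
    rw [show ((4 : ℕ) : ℝ) = 2 ^ 2 by norm_num, Real.sqrt_sq (by norm_num)]
  rwa [e] at h

/-- … and a field concentrated on one bond of the `2·2`-torus forces `C² ≥ 2⁴ = 16` at level `k = 1`. -/
example {A : Matrix (Fin 2) (Fin 2) ℂ} (hA : A ≠ 0) {m : Site 4 → Fin 4 → ℝ} {C : ℝ}
    (h : LocalSupMajorant (d := 4) 2 1 1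
      (fun (x : Site 4) (μ : Fin 4) => if x = (fun _ => 0) ∧ μ = 0 then A else (0 : Matrix (Fin 2) (Fin 2) ℂ)) m C) :
    (16 : ℝ) ≤ C ^ 2 := by
  have hx₀ : (fun (_ : Fin 4) => (0 : ℤ)) ∈ periodBox (d := 4) (1 * 2 ^ 1) := mem_periodBox.mpr fun _ => ⟨le_rfl, by norm_num⟩
  have h16 := sq_le_of_oneBond (d := 4) (L := 2) (N := 1) (k := 1) (by norm_num) hx₀ (0 : Fin 4) hA h
  norm_num at h16
  exact h16

end

end Summit.QuantumFields.BalabanUV.T4Continuum.NE3LocalSupMajorantWitness
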